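import Mathlib
import HarnessLib
import Summits.HubbardSuperconductivity.HubbardSuperconductivity.Theorems.KLProgrammeKLRegimeVolumeLimitCutoffFrame
import Summits.HubbardSuperconductivity.HubbardSuperconductivity.Theorems.KLProgrammeKLRegimeVolumeLimitDoorsV14

/-!
# Gen-5 child `KLRegimeVolumeLimitV14` (stmt-HubbardSuperconductivity-19921) — the CUTOFF-FREE DOORS re-targeted to the re-based skeleton
# «cauchy» (tokens `klPredsV14.frameOK` / `TowerP klPredsV14`; seat hubbard-kl-k3c5-p3 g4, technique «OS-positivity-free direct assembly»)

The gen-5 resplit (route rev 17/18, 2026-08-27T03:18Z) retired stmt-…-19858 (`KLRegimeVolumeLimitV12`) in favour of stmt-…-19921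
`KLRegimeVolumeLimitV14 := VolumeLimitP2 klPredsV14 FinalTwoLegVolLimitEx klWindowC`, whose skeleton «cauchy» (k3c4-p1, f5b495cbb8e8ff52) has the
SAME two stubs with `klPredsV12 ↦ klPredsV14`.  The cutoff-removal theorems of `…VolumeLimitCutoffRemoval` / `…CutoffDoor` / `…CutoffFrame` are
predicate-free except in their final wrappers; since `klPredsV14.frameOK = FrameOK` (`rfl`) and the tower is never used, the wrappers re-target
verbatim:

* `stub_vl_twoVolumeRate_of_cutoffFreeRate_V14` — the 19921 Cauchy stub ⟸ a two-volume rate of `klSelfEnergyInf L β U μ K` in the stub's regime;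
* `stub_vl_bound_of_cutoffFreeBound_V14` — the 19921 bound stub ⟸ an `L`-uniform bound on `klSelfEnergyInf L β U μ K` in the stub's regime;
* `stub_vl_bound_of_sixInf_bound_V14` — the 19921 bound stub ⟸ ∀ β>0 U μ, an `L`-uniform bound on the bare six-point coefficient `klSixInf`;
* `stub_vl_twoVolumeRate_of_bareRates_V14` — the 19921 Cauchy stub ⟸ in the regime: a rate of the density `klOccInf L`, a two-volume rate with
  momentum modulus of `klSixInf L n k`, and an `L`-uniform bound on it (BARE, SPIN-FREE, CUTOFF-FREE — the engine's minimal volume export).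
Everything is proved; no definition.
-/

noncomputable section

namespace Summit.HubbardSuperconductivity.HubbardSuperconductivity.Theorems.TwoPointAssembly

set_option linter.dupNamespace false -- summit = problem name (single-conjunct summit), D-0017

open Finset Filter Topology Literature.MathematicalPhysics.QuantumLattice Literature.Probability.LatticeModels GrassmannAlgebra
open Literature.MathematicalPhysics.QuantumLattice.FermiRG
open Summit.HubbardSuperconductivity.HubbardSuperconductivity.Theorems.DispersionFlow
open Summit.HubbardSuperconductivity.HubbardSuperconductivity.Theorems.KLRegimeSplit
open Summit.HubbardSuperconductivity.HubbardSuperconductivity.Theorems.KLProgrammeLegKernels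

/-- **THE DOOR FOR `stub_vl_twoVolumeRate` OF `KLRegimeVolumeLimitV14` (stmt-…-19921), cutoff-free form.**  IF, for every datum of the registered stub (constant records,
regime point, admissible frame, tower), the CUTOFF-FREE carrier has a two-volume rate
`∃ L₀ D ρ, ρ → 0 ∧ ∀ L₀ ≤ L ≤ L′ ∀ n k k′, ‖klSelfEnergyInf L β U μ K n k − klSelfEnergyInf L′ β U μ K n k′‖ ≤ ρ L + D·Σ_i |p_k i − p′_{k′} i|_𝕋`,
THEN the registered Cauchy stub holds verbatim. -/
theorem stub_vl_twoVolumeRate_of_cutoffFreeRate_V14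
    (hvol : ∀ (G : GeoConsts) (P : SplitConsts) (Q : EngConsts) (R : RenConsts), G.WF → P.WF → Q.WF → R.WF →
      ∃ c₅ : ℝ, 0 < c₅ ∧ ∀ c : ℝ, 0 < c → c ≤ c₅ → ∃ U₀ : ℝ, 0 < U₀ ∧
        ∀ μ ∈ klWindowC, ∀ U : ℝ, 0 < U → U ≤ U₀ → ∀ β : ℝ, klBetaMin ≤ β → β ≤ Real.exp (c / U ^ 2) →
          ∀ K : TrigPolyC4v, klPredsV14.frameOK R U (nScales β) μ K →
            ∀ (Lstar : ℕ) (Mstar : ℕ → ℕ), TowerP klPredsV14 G P Q R β U μ K Lstar Mstar →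
              ∃ L₀ : ℕ, ∃ D : ℝ, ∃ ρ : ℕ → ℝ, Tendsto ρ atTop (𝓝 0) ∧
                ∀ (L : ℕ) [NeZero L], L₀ ≤ L → ∀ (L' : ℕ) [NeZero L'], L ≤ L' →
                  ∀ (n : ℤ) (k : TorusSite 2 L) (k' : TorusSite 2 L'),
                    ‖klSelfEnergyInf L β U μ K n k - klSelfEnergyInf L' β U μ K n k'‖ ≤
                      ρ L + D * ∑ i, torusAbs (latticeMomentum L k i - latticeMomentum L' k' i)) :
    ∀ (G : GeoConsts) (P : SplitConsts) (Q : EngConsts) (R : RenConsts), G.WF → P.WF → Q.WF → R.WF →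
      ∃ c₅ : ℝ, 0 < c₅ ∧ ∀ c : ℝ, 0 < c → c ≤ c₅ → ∃ U₀ : ℝ, 0 < U₀ ∧
        ∀ μ ∈ klWindowC, ∀ U : ℝ, 0 < U → U ≤ U₀ → ∀ β : ℝ, klBetaMin ≤ β → β ≤ Real.exp (c / U ^ 2) →
          ∀ K : TrigPolyC4v, klPredsV14.frameOK R U (nScales β) μ K →
            ∀ (Lstar : ℕ) (Mstar : ℕ → ℕ), TowerP klPredsV14 G P Q R β U μ K Lstar Mstar →
              ∃ L₀ : ℕ, ∃ Mth : ℕ → ℕ, ∃ D : ℝ, ∃ ρ : ℕ → ℝ, Tendsto ρ atTop (𝓝 0) ∧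
                ∀ (L : ℕ) [NeZero L], L₀ ≤ L → ∀ (M : ℕ) [NeZero M], Mth L ≤ M →
                  ∀ (L' : ℕ) [NeZero L'], L ≤ L' → ∀ (M' : ℕ) [NeZero M'], Mth L' ≤ M' →
                    ∀ (σ : Fin 2) (ω : MatsubaraIdx M) (ω' : MatsubaraIdx M'), matsubaraInt M ω = matsubaraInt M' ω' →
                      ∀ (k : TorusSite 2 L) (k' : TorusSite 2 L'),
                        ‖klSelfEnergy L M β U μ K klE0 (nScales β + 1) (ω, k) σ -
                            klSelfEnergy L' M' β U μ K klE0 (nScales β + 1) (ω', k') σ‖ ≤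
                          ρ L + D * ∑ i, torusAbs (latticeMomentum L k i - latticeMomentum L' k' i) := by
  intro G P Q R hG hP hQ hR
  obtain ⟨c₅, hc₅, hc⟩ := hvol G P Q R hG hP hQ hR
  refine ⟨c₅, hc₅, fun c hc0 hcc => ?_⟩
  obtain ⟨U₀, hU₀, hU⟩ := hc c hc0 hcc
  refine ⟨U₀, hU₀, fun μ hμ U hU0 hUU β hβmin hβmax K hK Lstar Mstar hT => ?_⟩
  have hβ : 0 < β := pos_of_klBetaMin_le hβmin
  obtain ⟨L₀, D, ρ, hρ, hv⟩ := hU μ hμ U hU0 hUU β hβmin hβmax K hK Lstar Mstar hT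
  exact twoVolumeRate_of_cutoffFreeRate hβ U μ K hρ hv

/-- **THE DOOR FOR `stub_vl_bound` OF `KLRegimeVolumeLimitV14` (stmt-…-19921), cutoff-free form.**  IF, for every datum of the registered stub, the
CUTOFF-FREE carrier is bounded uniformly in the volume, `∃ B L₀, ∀ L ≥ L₀ ∀ n p, ‖klSelfEnergyInf L β U μ K n p‖ ≤ B`, THEN the registered
`stub_vl_bound` text holds verbatim. -/
theorem stub_vl_bound_of_cutoffFreeBound_V14
    (hbd : ∀ (G : GeoConsts) (P : SplitConsts) (Q : EngConsts) (R : RenConsts), G.WF → P.WF → Q.WF → R.WF →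
      ∃ c₅ : ℝ, 0 < c₅ ∧ ∀ c : ℝ, 0 < c → c ≤ c₅ → ∃ U₀ : ℝ, 0 < U₀ ∧
        ∀ μ ∈ klWindowC, ∀ U : ℝ, 0 < U → U ≤ U₀ → ∀ β : ℝ, klBetaMin ≤ β → β ≤ Real.exp (c / U ^ 2) →
          ∀ K : TrigPolyC4v, klPredsV14.frameOK R U (nScales β) μ K →
            ∀ (Lstar : ℕ) (Mstar : ℕ → ℕ), TowerP klPredsV14 G P Q R β U μ K Lstar Mstar →
              ∃ B : ℝ, ∃ L₀ : ℕ, ∀ (L : ℕ) [NeZero L], L₀ ≤ L → ∀ (n : ℤ) (p : TorusSite 2 L), ‖klSelfEnergyInf L β U μ K n p‖ ≤ B) :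
    ∀ (G : GeoConsts) (P : SplitConsts) (Q : EngConsts) (R : RenConsts), G.WF → P.WF → Q.WF → R.WF →
      ∃ c₅ : ℝ, 0 < c₅ ∧ ∀ c : ℝ, 0 < c → c ≤ c₅ → ∃ U₀ : ℝ, 0 < U₀ ∧
        ∀ μ ∈ klWindowC, ∀ U : ℝ, 0 < U → U ≤ U₀ → ∀ β : ℝ, klBetaMin ≤ β → β ≤ Real.exp (c / U ^ 2) →
          ∀ K : TrigPolyC4v, klPredsV14.frameOK R U (nScales β) μ K →
            ∀ (Lstar : ℕ) (Mstar : ℕ → ℕ), TowerP klPredsV14 G P Q R β U μ K Lstar Mstar →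
              ∃ B : ℝ, ∃ L₀ : ℕ, ∃ Mth : ℕ → ℕ, ∀ (L : ℕ) [NeZero L], L₀ ≤ L → ∀ (M : ℕ) [NeZero M], Mth L ≤ M →
                ∀ (k : FreqMomentum L M) (σ : Fin 2), ‖klSelfEnergy L M β U μ K klE0 (nScales β + 1) k σ‖ ≤ B := by
  intro G P Q R hG hP hQ hR
  obtain ⟨c₅, hc₅, hc⟩ := hbd G P Q R hG hP hQ hR
  refine ⟨c₅, hc₅, fun c hc0 hcc => ?_⟩
  obtain ⟨U₀, hU₀, hU⟩ := hc c hc0 hcc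
  refine ⟨U₀, hU₀, fun μ hμ U hU0 hUU β hβmin hβmax K hK Lstar Mstar hT => ?_⟩
  have hβ : 0 < β := pos_of_klBetaMin_le hβmin
  obtain ⟨B, L₀, hB⟩ := hU μ hμ U hU0 hUU β hβmin hβmax K hK Lstar Mstar hT
  obtain ⟨Mth, hMth⟩ := uniformBound_of_cutoffFreeBound hβ U μ K hB
  exact ⟨B + 1, max L₀ 3, Mth, hMth⟩

/-- **`stub_vl_bound` FROM ONE `L`-UNIFORM BOUND ON THE BARE SIX-POINT COEFFICIENT.**  IF for every `β > 0`, `U`, `μ`: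
`∃ B L₀, ∀ L ≥ L₀ ∀ n p, ‖klSixInf L β U μ n p‖ ≤ B` (the cutoff-free current–current Matsubara coefficient, bounded uniformly in the
volume, the integer label and the momentum), THEN the registered `stub_vl_bound` text of `KLRegimeVolumeLimitV14` holds verbatim (bare frame `Σ∞⁰ = U·occ∞ + U²·Six∞`,
`‖occ∞‖ ≤ 3/2`; all frames by k3c4-p1's `stub_vl_bound_of_bareFrameBound_V14`). -/
theorem stub_vl_bound_of_sixInf_bound_V14
    (hsix : ∀ β : ℝ, 0 < β → ∀ U μ : ℝ, ∃ B : ℝ, ∃ L₀ : ℕ, ∀ (L : ℕ) [NeZero L], L₀ ≤ L →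
      ∀ (n : ℤ) (p : TorusSite 2 L), ‖klSixInf L β U μ n p‖ ≤ B) :
    ∀ (G : GeoConsts) (P : SplitConsts) (Q : EngConsts) (R : RenConsts), G.WF → P.WF → Q.WF → R.WF →
      ∃ c₅ : ℝ, 0 < c₅ ∧ ∀ c : ℝ, 0 < c → c ≤ c₅ → ∃ U₀ : ℝ, 0 < U₀ ∧
        ∀ μ ∈ klWindowC, ∀ U : ℝ, 0 < U → U ≤ U₀ → ∀ β : ℝ, klBetaMin ≤ β → β ≤ Real.exp (c / U ^ 2) →
          ∀ K : TrigPolyC4v, klPredsV14.frameOK R U (nScales β) μ K →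
            ∀ (Lstar : ℕ) (Mstar : ℕ → ℕ), TowerP klPredsV14 G P Q R β U μ K Lstar Mstar →
              ∃ B : ℝ, ∃ L₀ : ℕ, ∃ Mth : ℕ → ℕ, ∀ (L : ℕ) [NeZero L], L₀ ≤ L → ∀ (M : ℕ) [NeZero M], Mth L ≤ M →
                ∀ (k : FreqMomentum L M) (σ : Fin 2), ‖klSelfEnergy L M β U μ K klE0 (nScales β + 1) k σ‖ ≤ B := by
  refine stub_vl_bound_of_bareFrameBound_V14 fun β hβ U μ => ?_
  obtain ⟨B, L₀, hB⟩ := hsix β hβ U μ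
  -- the cutoff-free bare carrier is bounded by `|U|·3/2 + U²·B`
  have hinf : ∀ (L : ℕ) [NeZero L], L₀ ≤ L → ∀ (n : ℤ) (p : TorusSite 2 L),
      ‖klSelfEnergyInf L β U μ 0 n p‖ ≤ |U| * (3 / 2) + U ^ 2 * max B 0 := by
    intro L _ hL n p
    rw [klSelfEnergyInf_zero_frame hβ.ne']
    refine (norm_add_le _ _).trans (add_le_add ?_ ?_)
    · rw [norm_mul, Complex.norm_real, Real.norm_eq_abs]
      exact mul_le_mul_of_nonneg_left (norm_klOccInf_le β U μ) (abs_nonneg U)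
    · rw [norm_mul, norm_pow, Complex.norm_real, Real.norm_eq_abs, sq_abs]
      exact mul_le_mul_of_nonneg_left ((hB L hL n p).trans (le_max_left _ _)) (sq_nonneg U)
  obtain ⟨Mth, hMth⟩ := uniformBound_of_cutoffFreeBound hβ U μ 0 hinf
  exact ⟨|U| * (3 / 2) + U ^ 2 * max B 0 + 1, max L₀ 3, Mth, fun L _ hL M _ hM k => hMth L hL M hM k 0⟩

/-- **`stub_vl_twoVolumeRate` FROM BARE, SPIN-FREE, CUTOFF-FREE VOLUME STATEMENTS.**  IF, for every datum of the registered stub, there are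
`L₀ D₂ B ρ₁ ρ₂` with `ρ₁ → 0`, `ρ₂ → 0` and, beyond `L₀`: a rate of the density `‖klOccInf L β U μ − klOccInf L′ β U μ‖ ≤ ρ₁ L`, a
two-volume rate `‖klSixInf L β U μ n k − klSixInf L′ β U μ n k′‖ ≤ ρ₂ L + D₂·Σ_i |p_k i − p′_{k′} i|_𝕋` and a bound `‖klSixInf L β U μ n k‖ ≤ B`,
THEN the registered Cauchy stub of `KLRegimeVolumeLimitV14` (stmt-…-19921) holds verbatim (frame by `cutoffFreeRate_of_bareRates` with the stub's own
`FrameOK`, cutoff by `twoVolumeRate_of_cutoffFreeRate`). -/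
theorem stub_vl_twoVolumeRate_of_bareRates_V14
    (hbare : ∀ (G : GeoConsts) (P : SplitConsts) (Q : EngConsts) (R : RenConsts), G.WF → P.WF → Q.WF → R.WF →
      ∃ c₅ : ℝ, 0 < c₅ ∧ ∀ c : ℝ, 0 < c → c ≤ c₅ → ∃ U₀ : ℝ, 0 < U₀ ∧
        ∀ μ ∈ klWindowC, ∀ U : ℝ, 0 < U → U ≤ U₀ → ∀ β : ℝ, klBetaMin ≤ β → β ≤ Real.exp (c / U ^ 2) →
          ∀ K : TrigPolyC4v, klPredsV14.frameOK R U (nScales β) μ K →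
            ∀ (Lstar : ℕ) (Mstar : ℕ → ℕ), TowerP klPredsV14 G P Q R β U μ K Lstar Mstar →
              ∃ L₀ : ℕ, ∃ D₂ : ℝ, ∃ B : ℝ, ∃ ρ₁ : ℕ → ℝ, ∃ ρ₂ : ℕ → ℝ, Tendsto ρ₁ atTop (𝓝 0) ∧ Tendsto ρ₂ atTop (𝓝 0) ∧
                (∀ (L : ℕ) [NeZero L], L₀ ≤ L → ∀ (L' : ℕ) [NeZero L'], L ≤ L' → ‖klOccInf L β U μ - klOccInf L' β U μ‖ ≤ ρ₁ L) ∧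
                (∀ (L : ℕ) [NeZero L], L₀ ≤ L → ∀ (L' : ℕ) [NeZero L'], L ≤ L' →
                  ∀ (n : ℤ) (k : TorusSite 2 L) (k' : TorusSite 2 L'),
                    ‖klSixInf L β U μ n k - klSixInf L' β U μ n k'‖ ≤
                      ρ₂ L + D₂ * ∑ i, torusAbs (latticeMomentum L k i - latticeMomentum L' k' i)) ∧
                (∀ (L : ℕ) [NeZero L], L₀ ≤ L → ∀ (n : ℤ) (k : TorusSite 2 L), ‖klSixInf L β U μ n k‖ ≤ B)) :
    ∀ (G : GeoConsts) (P : SplitConsts) (Q : EngConsts) (R : RenConsts), G.WF → P.WF → Q.WF → R.WF →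
      ∃ c₅ : ℝ, 0 < c₅ ∧ ∀ c : ℝ, 0 < c → c ≤ c₅ → ∃ U₀ : ℝ, 0 < U₀ ∧
        ∀ μ ∈ klWindowC, ∀ U : ℝ, 0 < U → U ≤ U₀ → ∀ β : ℝ, klBetaMin ≤ β → β ≤ Real.exp (c / U ^ 2) →
          ∀ K : TrigPolyC4v, klPredsV14.frameOK R U (nScales β) μ K →
            ∀ (Lstar : ℕ) (Mstar : ℕ → ℕ), TowerP klPredsV14 G P Q R β U μ K Lstar Mstar →
              ∃ L₀ : ℕ, ∃ Mth : ℕ → ℕ, ∃ D : ℝ, ∃ ρ : ℕ → ℝ, Tendsto ρ atTop (𝓝 0) ∧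
                ∀ (L : ℕ) [NeZero L], L₀ ≤ L → ∀ (M : ℕ) [NeZero M], Mth L ≤ M →
                  ∀ (L' : ℕ) [NeZero L'], L ≤ L' → ∀ (M' : ℕ) [NeZero M'], Mth L' ≤ M' →
                    ∀ (σ : Fin 2) (ω : MatsubaraIdx M) (ω' : MatsubaraIdx M'), matsubaraInt M ω = matsubaraInt M' ω' →
                      ∀ (k : TorusSite 2 L) (k' : TorusSite 2 L'),
                        ‖klSelfEnergy L M β U μ K klE0 (nScales β + 1) (ω, k) σ -
                            klSelfEnergy L' M' β U μ K klE0 (nScales β + 1) (ω', k') σ‖ ≤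
                          ρ L + D * ∑ i, torusAbs (latticeMomentum L k i - latticeMomentum L' k' i) := by
  refine stub_vl_twoVolumeRate_of_cutoffFreeRate_V14 fun G P Q R hG hP hQ hR => ?_
  obtain ⟨c₅, hc₅, hc⟩ := hbare G P Q R hG hP hQ hR
  refine ⟨c₅, hc₅, fun c hc0 hcc => ?_⟩
  obtain ⟨U₀, hU₀, hU⟩ := hc c hc0 hcc
  refine ⟨U₀, hU₀, fun μ hμ U hU0 hUU β hβmin hβmax K hK Lstar Mstar hT => ?_⟩
  have hβ : 0 < β := pos_of_klBetaMin_le hβmin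
  obtain ⟨L₀, D₂, B, ρ₁, ρ₂, hρ₁, hρ₂, hocc, hsix, hsixB⟩ := hU μ hμ U hU0 hUU β hβmin hβmax K hK Lstar Mstar hT
  have hK' : FrameOK R U (nScales β) μ K := hK
  obtain ⟨D, ρ, hρ, h⟩ := cutoffFreeRate_of_bareRates hβ hK' U hρ₁ hρ₂ hocc hsix hsixB
  exact ⟨L₀, D, ρ, hρ, h⟩

end Summit.HubbardSuperconductivity.HubbardSuperconductivity.Theorems.TwoPointAssembly

end
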